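import Literature.NumberTheory.Automorphic.UnitaryTwoTreeActionDescent        -- ★ B-p08 (g28) (W1c)-B: `rhoVertexAct`, `rhoGL_spec`
import Literature.NumberTheory.Automorphic.UnitaryTwoAntidiagProjectiveDescent -- ★ F0P3a-p04 (g13) (W1): `det_mul_map_det_eq_one_of_mem_unitaryGroupOfForm_antidiag_two`
import Literature.NumberTheory.Automorphic.HermitianLatticeTreeTransitive     -- ★ F0P2-p02 (g9): `isUnimodular₂_iff_exists_mem_glInt`
import HarnessLib

/-!
# Stabilisers of the vertices of the tree of `SL₂(F)` under `U(Φ₂)(E)` at a RAMIFIED quadratic `E ∕ F`: `Stab_U(latt h) = {u : ι(h)⁻¹ · diag(1,α) u diag(1,α)⁻¹ · ι(h)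
# is unimodular}` — the levels `K`, `K♯_D` of the Euler–Poincaré relation (Serre, *Trees* II.1.3; Tits 1979 §3.9; Kottwitz 1988 §2)

Topic `NumberTheory/Automorphic`; namespace `Literature.NumberTheory.Automorphic.UnitaryGroup` (tree-side lemma in `…HermitianLatticeTree`).  THEOREMS ONLY (no definition, no
instance, no notation, no named fact, no `sorry`); kernel lane.  Cell `pub/hodgecm-mathlib` (D-0151), crux H413 = `stmt-HodgeConjecture-24833`, line «N6nsGerm», residue
«R2EP-wild» of `stub_N6nsR2EP : RankOneEulerPoincareNonsplit`, ROAD W brick (W2) part 1 (census `B-provers/B-p08/g28/CENSUS-W1c-W2-TreeAction.B-p08g28.md`; road memo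
(S4)).  GENERIC in the sense of ★ (W1c)-B: `ι : F →+* E`, `σ`, `α` (`σα = −α ≠ 0`), the descent property `hρ` a hypothesis; the place enters only through FOUR valuation facts,
all immediate at a ramified place of a quadratic extension (`|ι x|_E = |x|_F²`, ★ `valued_toPlace` with `e = 2`): `hιO : |ι x| ≤ 1 ↔ |x| ≤ 1`; `hcov : ∀ s ≠ 0, ∃ c ≠ 0,
|s ι(c)| ∈ {1, |ϖ_E|}` (every value of `E` is an `F`-value up to at most one `ϖ_E`); `hgap : |ι x| ≤ |ϖ_E|⁻¹ → |ι x| ≤ 1` (no `F`-value strictly between `1` and `|ϖ_E|⁻¹`);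
`hσv : |σ x| = |x|`.  HONEST LABEL: HC_CM is proved only modulo the cell's 2 remaining named inputs (hLiu418, h413) until rung 0 closes; nothing printed is asserted here.

THE MATHEMATICS.  §1 (tree side) `g · latt h = latt h` iff `h⁻¹ g h ∈ F^× · GL₂(𝒪_F)` (`glVertexAct_eq_self_iff`).  §2 (CORE) for `Y = s · ι(g)` with `|det Y| = 1`:
`g ∈ F^× · GL₂(𝒪_F)` iff `Y` is UNIMODULAR (integral entries, unit determinant) — «⇒»: `|s ι(c)|² · |ι det k| = 1` forces `|s ι(c)| = 1`; «⇐»: rescale by `hcov`; if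
`|s ι(c)| = 1` then `ι(c⁻¹g)` is unimodular, hence `c⁻¹ g ∈ GL₂(𝒪_F)` by `hιO`; if `|s ι(c)| = |ϖ_E|` the entries of `ι(c⁻¹g)` are `≤ |ϖ_E|⁻¹`, hence `≤ 1` (`hgap`), so
`|det (c⁻¹g)| ≤ 1`, contradicting `|ι det(c⁻¹g)| = |ϖ_E|⁻² > 1` (`exists_scalar_mul_glInt_iff_isUnimodular₂`).  §3 For `u ∈ U(Φ₂)` one has `|det u| = 1` (`σ(det u) det u = 1`),
so with `Y = ι(h)⁻¹ · diag(1,α) u diag(1,α)⁻¹ · ι(h) = s · ι(h⁻¹ g h)`: **`rhoVertexAct_eq_self_iff_isUnimodular₂`** (`ρ(u)` fixes `latt h` iff `Y` is unimodular), and its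
two instances **`rhoVertexAct_root_eq_self_iff`** (`v₀ = 𝒪²`: `diag(1,α) u diag(1,α)⁻¹` unimodular) and **`rhoVertexAct_rootNeighbour_eq_self_iff`** (`v₁ = 𝒪 ⊕ ϖ𝒪`:
`diag(1, α∕ι(ϖ)) u diag(1, α∕ι(ϖ))⁻¹` unimodular); §4 the dictionary `isUnimodular₂_conj_iff_mem_map_conj_glInt` with B-p14 (g32)'s level notation
`(glInt 2 E).map (MulAut.conj D)` (`D = diag(1,α)⁻¹`, resp. `D = diag(1, α∕ι(ϖ))⁻¹`; at a `√π`-type place `α ~ ϖ_E` these are `K♯_{diag(ϖ_E,1)}` and `K♯_{diag(1,ϖ_E)}`, at a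
`√u`-type place `K` and `K♯_{diag(1,ϖ_F)}`).

## References
* [Serre1980Trees] J.-P. Serre, *Trees* (1980), Ch. II §1.3 (stabilisers of vertices: `GL₂(𝒪)` and its conjugates, modulo the centre).
* [Tits1979] J. Tits, *Reductive groups over local fields*, PSPM 33.1 (1979), §3.9 (parahorics of the ramified quasi-split unitary group in two variables).
* [Kottwitz1988] R. E. Kottwitz, *Tamagawa numbers*, Ann. of Math. 127 (1988), §2.
-/

set_option autoImplicit false

noncomputable section

open scoped ValuativeRel Matrix MatrixGroups
open Matrix ValuativeRel

/-! ## §1 Tree side: the stabiliser of `latt h` in `GL₂(F)` is `h (F^× · GL₂(𝒪)) h⁻¹` -/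

namespace Literature.NumberTheory.Automorphic.HermitianLatticeTree

open Literature.NumberTheory.Automorphic

variable {F : Type*} [Field F] [ValuativeRel F] {ϖ : F} (hϖ : IsUniformizingElement ϖ) [IsDiscreteValuationRing 𝒪[F]]

omit [ValuativeRel F] [IsDiscreteValuationRing 𝒪[F]] in
/-- The scalar `c · 1 ∈ GL₂(F)` has matrix `c • 1`. [cite: Serre1980Trees, Ch. II §1.2] -/
theorem coe_units_map_scalar (c : Fˣ) :
    ((c.map ((Matrix.scalar (Fin 2) : F →+* Matrix (Fin 2) (Fin 2) F) : F →* Matrix (Fin 2) (Fin 2) F) : GL (Fin 2) F) : Matrix (Fin 2) (Fin 2) F) =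
      (c : F) • (1 : Matrix (Fin 2) (Fin 2) F) := by
  rw [Units.coe_map, MonoidHom.coe_coe, Matrix.scalar_apply, Matrix.smul_one_eq_diagonal]

omit [ValuativeRel F] [IsDiscreteValuationRing 𝒪[F]] in
/-- Scalars are central in `GL₂(F)`. [cite: Serre1980Trees, Ch. II §1.2] -/
theorem units_map_scalar_mul_comm (c : Fˣ) (x : GL (Fin 2) F) :
    c.map ((Matrix.scalar (Fin 2) : F →+* Matrix (Fin 2) (Fin 2) F) : F →* Matrix (Fin 2) (Fin 2) F) * x =
      x * c.map ((Matrix.scalar (Fin 2) : F →+* Matrix (Fin 2) (Fin 2) F) : F →* Matrix (Fin 2) (Fin 2) F) := by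
  ext : 1
  rw [Units.val_mul, Units.val_mul, coe_units_map_scalar, Matrix.smul_mul, Matrix.mul_smul, Matrix.one_mul, Matrix.mul_one]

include hϖ in
/-- **THE STABILISER OF A VERTEX `latt h` IN `GL₂(F)`**: `g · latt h = latt h` iff `h⁻¹ g h = (c · 1) k` with `c ∈ F^×`, `k ∈ GL₂(𝒪)` (Serre: `Stab(𝒪²) = F^×·GL₂(𝒪)` in
`GL₂(F)` acting on classes). [cite: Serre1980Trees, Ch. II §1.3] -/
theorem glVertexAct_eq_self_iff (h : GL (Fin 2) F)
    (v : {M : Submodule 𝒪[F] (Fin 2 → F) // IsSpecialLattice (RingHom.id F) ϖ !![(0 : F), 1; -1, 0] M})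
    (hv : v.1 = latt (h : Matrix (Fin 2) (Fin 2) F)) (g : GL (Fin 2) F) :
    glVertexAct hϖ g v = v ↔ ∃ (c : Fˣ) (k : GL (Fin 2) F), k ∈ glInt 2 F ∧
      h⁻¹ * g * h = c.map ((Matrix.scalar (Fin 2) : F →+* Matrix (Fin 2) (Fin 2) F) : F →* Matrix (Fin 2) (Fin 2) F) * k := by
  have h0 := hϖ.ne_zero
  rw [glVertexAct_eq_iff]
  simp only [hv, mapGL_latt, scaleLattice_latt]
  constructor
  · rintro ⟨m, hm⟩
    set cm : Fˣ := (Units.mk0 ϖ h0) ^ m with hcm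
    have hcmval : ((cm.map ((Matrix.scalar (Fin 2) : F →+* Matrix (Fin 2) (Fin 2) F) : F →* Matrix (Fin 2) (Fin 2) F) * (g * h) : GL (Fin 2) F) :
        Matrix (Fin 2) (Fin 2) F) = ϖ ^ m • ((g * h : GL (Fin 2) F) : Matrix (Fin 2) (Fin 2) F) := by
      rw [Units.val_mul, coe_units_map_scalar, Matrix.smul_mul, Matrix.one_mul, hcm, Units.val_zpow_eq_zpow_val, Units.val_mk0]
    rw [← hcmval] at hm
    have hk := (span_range_transpose_eq_iff h _).1 hm
    refine ⟨cm⁻¹, h⁻¹ * (cm.map ((Matrix.scalar (Fin 2) : F →+* Matrix (Fin 2) (Fin 2) F) : F →* Matrix (Fin 2) (Fin 2) F) * (g * h)), hk, ?_⟩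
    -- scalars are central: `cm⁻¹ (h⁻¹ (cm (g h))) = h⁻¹ g h`
    rw [units_map_scalar_mul_comm cm (g * h), ← mul_assoc h⁻¹, ← mul_assoc, units_map_scalar_mul_comm cm⁻¹, mul_assoc (h⁻¹ * (g * h)), ← map_mul,
      inv_mul_cancel, map_one, mul_one, mul_assoc]
  · rintro ⟨c, k, hk, hghk⟩
    obtain ⟨a, e, he, hce⟩ := exists_eq_zpow_mul_of_ne_zero hϖ c.ne_zero
    refine ⟨-a, ?_⟩
    have hgh : ((g * h : GL (Fin 2) F) : Matrix (Fin 2) (Fin 2) F) = (c : F) • ((h * k : GL (Fin 2) F) : Matrix (Fin 2) (Fin 2) F) := by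
      rw [show g * h = h * (h⁻¹ * g * h) by rw [mul_assoc, mul_inv_cancel_left], hghk, units_map_scalar_mul_comm, ← mul_assoc, Units.val_mul (h * k),
        coe_units_map_scalar, Matrix.mul_smul, Matrix.mul_one]
    rw [hgh, smul_smul, hce, show ϖ ^ (-a) * (ϖ ^ a * e) = e by rw [← mul_assoc, ← zpow_add₀ h0, neg_add_cancel, zpow_zero, one_mul], ← scaleLattice_latt,
      scaleLattice_latt_eq_of_valuation_eq_one he, latt_mul_of_mem_glInt h k hk]

end Literature.NumberTheory.Automorphic.HermitianLatticeTree

/-! ## §2 The core: `s · ι(g)` unimodular iff `g ∈ F^× · GL₂(𝒪_F)` -/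

namespace Literature.NumberTheory.Automorphic.UnitaryGroup

open Literature.NumberTheory.Automorphic Literature.NumberTheory.Automorphic.HermitianLatticeTree

variable {F : Type*} [Field F] [ValuativeRel F] {E : Type*} [Field E] [ValuativeRel E] (ι : F →+* E) (σ : E →+* E) {α : E}

omit [ValuativeRel F] [ValuativeRel E] in
/-- In a linearly ordered value group, a non-zero `y` is `1` iff `y ≤ 1` and `y⁻¹ ≤ 1`. [cite: Serre1980Trees, Ch. II §1.3] -/
theorem eq_one_iff_le_one_and_inv_le_one {Γ : Type*} [LinearOrderedCommGroupWithZero Γ] {y : Γ} (hy : y ≠ 0) : y = 1 ↔ y ≤ 1 ∧ y⁻¹ ≤ 1 := by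
  constructor
  · rintro rfl; exact ⟨le_rfl, by rw [inv_one]⟩
  · rintro ⟨h1, h2⟩
    exact le_antisymm h1 (by rwa [inv_le_one₀ (zero_lt_iff.2 hy)] at h2)

/-- `|ι x| ≤ 1 ↔ |x| ≤ 1` upgrades to `|ι x| = 1 ↔ |x| = 1` (apply it to `x` and `x⁻¹`). [cite: Serre1980Trees, Ch. II §1.3] -/
theorem valuation_map_eq_one_iff (hιO : ∀ x : F, valuation E (ι x) ≤ 1 ↔ valuation F x ≤ 1) (x : F) :
    valuation E (ι x) = 1 ↔ valuation F x = 1 := by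
  by_cases hx : x = 0
  · rw [hx, map_zero, map_zero, map_zero]; simp
  have hιx : ι x ≠ 0 := by rw [map_ne_zero]; exact hx
  rw [eq_one_iff_le_one_and_inv_le_one ((Valuation.ne_zero_iff _).2 hιx), eq_one_iff_le_one_and_inv_le_one ((Valuation.ne_zero_iff _).2 hx),
    ← map_inv₀, ← map_inv₀, ← map_inv₀, hιO, hιO]

omit [ValuativeRel F] [ValuativeRel E] in
/-- `(c · 1) k` has image `ι(c) · ι(k)`. [cite: Serre1980Trees, Ch. II §1.2] -/
theorem map_coe_units_map_scalar_mul (c : Fˣ) (k : GL (Fin 2) F) :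
    (((c.map ((Matrix.scalar (Fin 2) : F →+* Matrix (Fin 2) (Fin 2) F) : F →* Matrix (Fin 2) (Fin 2) F) * k : GL (Fin 2) F)) : Matrix (Fin 2) (Fin 2) F).map ι =
      ι c • (k : Matrix (Fin 2) (Fin 2) F).map ι := by
  rw [Units.val_mul, coe_units_map_scalar, Matrix.smul_mul, Matrix.one_mul, Matrix.map_smul' ι (c : F) _ (map_mul ι)]

/-- In a linearly ordered value group, `y² = 1` forces `y = 1`. [cite: Serre1980Trees, Ch. II §1.3] -/
theorem eq_one_of_sq_eq_one {Γ : Type*} [LinearOrderedCommGroupWithZero Γ] {y : Γ} (h : y ^ 2 = 1) : y = 1 := by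
  rcases lt_trichotomy y 1 with hy | hy | hy
  · exact absurd h (ne_of_lt (pow_lt_one₀ zero_le hy two_ne_zero))
  · exact hy
  · exact absurd h (ne_of_gt (one_lt_pow₀ hy two_ne_zero))

/-- **THE CORE.**  For `Y = s · ι(g)` (`s ≠ 0`) with `|det Y| = 1`: `g ∈ F^× · GL₂(𝒪_F)` iff `Y` is unimodular — under `hιO`, `hcov`, `hgap` (see the file header; all three hold
at a ramified place of a quadratic extension). [cite: Serre1980Trees, Ch. II §1.3] [cite: Tits1979, §3.9] -/
theorem exists_scalar_mul_glInt_iff_isUnimodular₂ (hιO : ∀ x : F, valuation E (ι x) ≤ 1 ↔ valuation F x ≤ 1) {ϖE : E} (hϖE : valuation E ϖE < 1)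
    (hcov : ∀ s : E, s ≠ 0 → ∃ c : F, c ≠ 0 ∧ (valuation E (s * ι c) = 1 ∨ valuation E (s * ι c) = valuation E ϖE))
    (hgap : ∀ x : F, valuation E (ι x) ≤ (valuation E ϖE)⁻¹ → valuation E (ι x) ≤ 1)
    {Y : Matrix (Fin 2) (Fin 2) E} {s : E} {g : GL (Fin 2) F} (hs : s ≠ 0) (hY : Y = s • (g : Matrix (Fin 2) (Fin 2) F).map ι) (hdet : valuation E Y.det = 1) :
    (∃ (c : Fˣ) (k : GL (Fin 2) F), k ∈ glInt 2 F ∧ g = c.map ((Matrix.scalar (Fin 2) : F →+* Matrix (Fin 2) (Fin 2) F) : F →* Matrix (Fin 2) (Fin 2) F) * k) ↔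
      IsUnimodular₂ Y := by
  -- bookkeeping: for `g = (c·1) k`, `Y = (s ι c) • ι(k)`, entries `Y i j = s ι(c) ι(k i j)`, `det Y = (s ι c)² ι(det k)`
  have hbook : ∀ (c : Fˣ) (k : GL (Fin 2) F), g = c.map ((Matrix.scalar (Fin 2) : F →+* Matrix (Fin 2) (Fin 2) F) : F →* Matrix (Fin 2) (Fin 2) F) * k →
      (∀ i j, Y i j = s * ι c * ι ((k : Matrix (Fin 2) (Fin 2) F) i j)) ∧ Y.det = (s * ι c) ^ 2 * ι (k : Matrix (Fin 2) (Fin 2) F).det := by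
    intro c k hgk
    have hYk : Y = (s * ι c) • (k : Matrix (Fin 2) (Fin 2) F).map ι := by rw [hY, hgk, map_coe_units_map_scalar_mul, smul_smul]
    refine ⟨fun i j => by rw [hYk, Matrix.smul_apply, Matrix.map_apply, smul_eq_mul], ?_⟩
    rw [hYk, Matrix.det_smul, Fintype.card_fin, RingHom.map_det, RingHom.mapMatrix_apply]
  constructor
  · rintro ⟨c, k, hk, hgk⟩
    obtain ⟨hent, hdet'⟩ := hbook c k hgk
    have hdk : valuation E (ι (k : Matrix (Fin 2) (Fin 2) F).det) = 1 := (valuation_map_eq_one_iff ι hιO _).2 (valuation_det_eq_one_of_mem_glInt hk)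
    have hs1 : valuation E (s * ι c) = 1 := by
      rw [hdet', map_mul, map_pow, hdk, mul_one] at hdet
      exact eq_one_of_sq_eq_one hdet
    refine ⟨fun i j => ?_, hdet⟩
    rw [Valuation.mem_integer_iff, hent, map_mul, hs1, one_mul]
    exact (hιO _).2 ((Valuation.mem_integer_iff _ _).1 (isIntegralMatrix_of_mem_glInt hk i j))
  · intro hU
    obtain ⟨c₀, hc₀, hc⟩ := hcov s hs
    set c : Fˣ := Units.mk0 c₀ hc₀ with hcdef
    set k : GL (Fin 2) F := (c.map ((Matrix.scalar (Fin 2) : F →+* Matrix (Fin 2) (Fin 2) F) : F →* Matrix (Fin 2) (Fin 2) F))⁻¹ * g with hkdef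
    have hgk : g = c.map ((Matrix.scalar (Fin 2) : F →+* Matrix (Fin 2) (Fin 2) F) : F →* Matrix (Fin 2) (Fin 2) F) * k := by
      rw [hkdef, mul_inv_cancel_left]
    obtain ⟨hent, hdet'⟩ := hbook c k hgk
    have hcval : (c : F) = c₀ := rfl
    have hs'0 : s * ι c₀ ≠ 0 := mul_ne_zero hs (by rw [map_ne_zero]; exact hc₀)
    have hvs'0 : valuation E (s * ι c₀) ≠ 0 := (Valuation.ne_zero_iff _).2 hs'0
    -- entries of `ι(k)` and `ι(det k)` in terms of `Y`
    have hkent : ∀ i j, valuation E (ι ((k : Matrix (Fin 2) (Fin 2) F) i j)) = (valuation E (s * ι c₀))⁻¹ * valuation E (Y i j) := by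
      intro i j
      rw [hent i j, hcval, map_mul (valuation E) (s * ι c₀), ← mul_assoc, inv_mul_cancel₀ hvs'0, one_mul]
    have hkdet : valuation E (ι (k : Matrix (Fin 2) (Fin 2) F).det) = ((valuation E (s * ι c₀)) ^ 2)⁻¹ := by
      have h := hdet
      rw [hdet', hcval, map_mul, map_pow] at h
      rw [← mul_eq_one_iff_eq_inv₀ (pow_ne_zero _ hvs'0), mul_comm, h]
    rcases hc with h1 | h2
    · -- `|s ι c₀| = 1`: `k ∈ GL₂(𝒪_F)`
      refine ⟨c, k, mem_glInt_of_isIntegralMatrix (fun i j => ?_) ?_, hgk⟩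
      · rw [Valuation.mem_integer_iff, ← hιO, hkent, h1, inv_one, one_mul]
        exact (Valuation.mem_integer_iff _ _).1 (hU.1 i j)
      · rw [← valuation_map_eq_one_iff ι hιO, hkdet, h1, one_pow, inv_one]
    · -- `|s ι c₀| = |ϖ_E|`: impossible
      exfalso
      have hϖE0 : valuation E ϖE ≠ 0 := by rw [← h2]; exact hvs'0
      have hkint : ∀ i j, (k : Matrix (Fin 2) (Fin 2) F) i j ∈ 𝒪[F] := by
        intro i j
        rw [Valuation.mem_integer_iff, ← hιO]
        apply hgap
        rw [hkent, h2]
        exact mul_le_of_le_one_right zero_le ((Valuation.mem_integer_iff _ _).1 (hU.1 i j))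
      have hdetint : valuation E (ι (k : Matrix (Fin 2) (Fin 2) F).det) ≤ 1 :=
        (hιO _).2 ((Valuation.mem_integer_iff _ _).1 (IsIntegralMatrix.det_mem hkint))
      rw [hkdet, h2, inv_le_one₀ (pow_pos (zero_lt_iff.2 hϖE0) _)] at hdetint
      exact absurd hdetint (not_le.2 (pow_lt_one₀ zero_le hϖE two_ne_zero))

/-! ## §3 The stabilisers of the vertices under `U(Φ₂)` -/

omit [ValuativeRel F] in
/-- `|det u| = 1` for `u ∈ U(Φ₂)` when `σ` preserves the valuation (`σ(det u) · det u = 1`). [cite: Tits1979, §3.9] -/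
theorem valuation_det_coe_eq_one_of_mem_unitaryGroupOfForm (hσv : ∀ x : E, valuation E (σ x) = valuation E x) {u : GL (Fin 2) E}
    (hu : u ∈ unitaryGroupOfForm σ !![(0 : E), 1; 1, 0]) : valuation E (u : Matrix (Fin 2) (Fin 2) E).det = 1 := by
  have h := congrArg (valuation E) (det_mul_map_det_eq_one_of_mem_unitaryGroupOfForm_antidiag_two σ hu)
  rw [map_mul, hσv, map_one, ← pow_two] at h
  exact eq_one_of_sq_eq_one h

section Stabilisers

variable {ϖ : F} (hϖ : IsUniformizingElement ϖ) [IsDiscreteValuationRing 𝒪[F]]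
  (hρ : ∀ u : GL (Fin 2) E, u ∈ unitaryGroupOfForm σ !![(0 : E), 1; 1, 0] →
      ∃ (s : E) (g : GL (Fin 2) F), s ≠ 0 ∧ Matrix.diagonal ![1, α] * (u : Matrix (Fin 2) (Fin 2) E) * Matrix.diagonal ![1, α⁻¹] =
        s • (g : Matrix (Fin 2) (Fin 2) F).map ι)
  (hσv : ∀ x : E, valuation E (σ x) = valuation E x) (hιO : ∀ x : F, valuation E (ι x) ≤ 1 ↔ valuation F x ≤ 1) {ϖE : E} (hϖE : valuation E ϖE < 1)
  (hcov : ∀ s : E, s ≠ 0 → ∃ c : F, c ≠ 0 ∧ (valuation E (s * ι c) = 1 ∨ valuation E (s * ι c) = valuation E ϖE))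
  (hgap : ∀ x : F, valuation E (ι x) ≤ (valuation E ϖE)⁻¹ → valuation E (ι x) ≤ 1) (hα0 : α ≠ 0)

include hσv hιO hϖE hcov hgap hα0 in
/-- **THE STABILISER OF THE VERTEX `latt h` UNDER `U(Φ₂)`**: `ρ(u) · latt h = latt h` iff `ι(h⁻¹) · diag(1,α) u diag(1,α)⁻¹ · ι(h)` is UNIMODULAR (integral entries, unit
determinant).  [cite: Serre1980Trees, Ch. II §1.3] [cite: Tits1979, §3.9] -/
theorem rhoVertexAct_eq_self_iff_isUnimodular₂ (u : ↥(unitaryGroupOfForm σ !![(0 : E), 1; 1, 0])) (h : GL (Fin 2) F)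
    (v : {M : Submodule 𝒪[F] (Fin 2 → F) // IsSpecialLattice (RingHom.id F) ϖ !![(0 : F), 1; -1, 0] M}) (hv : v.1 = latt (h : Matrix (Fin 2) (Fin 2) F)) :
    rhoVertexAct ι σ hϖ hρ u v = v ↔
      IsUnimodular₂ (((h⁻¹ : GL (Fin 2) F) : Matrix (Fin 2) (Fin 2) F).map ι *
        (Matrix.diagonal ![1, α] * ((u : GL (Fin 2) E) : Matrix (Fin 2) (Fin 2) E) * Matrix.diagonal ![1, α⁻¹]) * (h : Matrix (Fin 2) (Fin 2) F).map ι) := by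
  obtain ⟨s, hs, hY⟩ := rhoGL_spec ι σ hρ u
  rw [show rhoVertexAct ι σ hϖ hρ u v = glVertexAct hϖ (rhoGL ι σ hρ u) v from rfl, glVertexAct_eq_self_iff hϖ h v hv]
  refine exists_scalar_mul_glInt_iff_isUnimodular₂ ι hιO hϖE hcov hgap hs ?_ ?_
  · rw [hY, Units.val_mul, Units.val_mul, Matrix.map_mul, Matrix.map_mul, Matrix.mul_smul, Matrix.smul_mul]
  · -- `|det| = |det u| = 1`
    have hdd : (Matrix.diagonal ![(1 : E), α] * ((u : GL (Fin 2) E) : Matrix (Fin 2) (Fin 2) E) * Matrix.diagonal ![1, α⁻¹]).det =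
        ((u : GL (Fin 2) E) : Matrix (Fin 2) (Fin 2) E).det := by
      rw [det_mul, det_mul, det_diagonal, det_diagonal, Fin.prod_univ_two, Fin.prod_univ_two]
      simp only [Matrix.cons_val_zero, Matrix.cons_val_one, one_mul]
      rw [mul_comm, ← mul_assoc, inv_mul_cancel₀ hα0, one_mul]
    have hhh : (((h⁻¹ : GL (Fin 2) F) : Matrix (Fin 2) (Fin 2) F).map ι).det * ((h : Matrix (Fin 2) (Fin 2) F).map ι).det = 1 := by
      rw [← Matrix.det_mul, ← Matrix.map_mul, ← Units.val_mul, inv_mul_cancel, Units.val_one, Matrix.map_one ι (map_zero ι) (map_one ι), det_one]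
    rw [det_mul, det_mul, hdd, mul_comm, ← mul_assoc, mul_comm _ ((((h⁻¹ : GL (Fin 2) F) : Matrix (Fin 2) (Fin 2) F).map ι).det), hhh, one_mul]
    exact valuation_det_coe_eq_one_of_mem_unitaryGroupOfForm σ hσv u.2

include hσv hιO hϖE hcov hgap hα0 in
/-- **THE STABILISER OF THE ROOT `v₀ = 𝒪_F²`**: `ρ(u) · v₀ = v₀` iff `diag(1,α) u diag(1,α)⁻¹` is unimodular, i.e. `u ∈ U ∩ diag(1,α)⁻¹ GL₂(𝒪_E) diag(1,α)`
(`= K♯_{diag(ϖ_E, 1)}` at a `√π`-type place where `α ~ ϖ_E`, `= K = U ∩ GL₂(𝒪_E)` at a `√u`-type place where `α` is a unit). [cite: Serre1980Trees, Ch. II §1.3] [cite: Tits1979, §3.9] -/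
theorem rhoVertexAct_root_eq_self_iff (u : ↥(unitaryGroupOfForm σ !![(0 : E), 1; 1, 0]))
    (v₀ : {M : Submodule 𝒪[F] (Fin 2 → F) // IsSpecialLattice (RingHom.id F) ϖ !![(0 : F), 1; -1, 0] M}) (hv₀ : v₀.1 = latt (1 : Matrix (Fin 2) (Fin 2) F)) :
    rhoVertexAct ι σ hϖ hρ u v₀ = v₀ ↔
      IsUnimodular₂ (Matrix.diagonal ![1, α] * ((u : GL (Fin 2) E) : Matrix (Fin 2) (Fin 2) E) * Matrix.diagonal ![1, α⁻¹]) := by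
  have h := rhoVertexAct_eq_self_iff_isUnimodular₂ ι σ hϖ hρ hσv hιO hϖE hcov hgap hα0 u 1 v₀ (by rw [hv₀, Units.val_one])
  rwa [inv_one, Units.val_one, Matrix.map_one ι (map_zero ι) (map_one ι), Matrix.one_mul, Matrix.mul_one] at h

include hσv hιO hϖE hcov hgap hα0 in
/-- **THE STABILISER OF THE ROOT'S NEIGHBOUR `v₁ = 𝒪 ⊕ ϖ𝒪 = latt diag(1, ϖ)`**: `ρ(u) · v₁ = v₁` iff `diag(1, α∕ι(ϖ)) u diag(1, α∕ι(ϖ))⁻¹` is unimodular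
(`= K♯_{diag(1, ϖ_E)}` at a `√π`-type place, `= K♯_{diag(1, ϖ_F)} ∩ U` at a `√u`-type place). [cite: Serre1980Trees, Ch. II §1.3] [cite: Tits1979, §3.9] -/
theorem rhoVertexAct_rootNeighbour_eq_self_iff (u : ↥(unitaryGroupOfForm σ !![(0 : E), 1; 1, 0]))
    (v₁ : {M : Submodule 𝒪[F] (Fin 2 → F) // IsSpecialLattice (RingHom.id F) ϖ !![(0 : F), 1; -1, 0] M}) (hv₁ : v₁.1 = latt (Matrix.diagonal ![1, ϖ])) :
    rhoVertexAct ι σ hϖ hρ u v₁ = v₁ ↔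
      IsUnimodular₂ (Matrix.diagonal ![1, α * (ι ϖ)⁻¹] * ((u : GL (Fin 2) E) : Matrix (Fin 2) (Fin 2) E) * Matrix.diagonal ![1, (α * (ι ϖ)⁻¹)⁻¹]) := by
  have h0 := hϖ.ne_zero
  have hι0 : ι ϖ ≠ 0 := by rw [map_ne_zero]; exact h0
  obtain ⟨g₁, hg₁, -⟩ := exists_coe_eq_diagonal_one_uniformizer (F := F) h0
  have h := rhoVertexAct_eq_self_iff_isUnimodular₂ ι σ hϖ hρ hσv hιO hϖE hcov hgap hα0 u g₁ v₁ (by rw [hv₁, hg₁])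
  rw [h]
  -- `ι(g₁⁻¹) diag(1,α) = diag(1, α/ι(ϖ))` and `diag(1,α⁻¹) ι(g₁) = diag(1, (α/ι(ϖ))⁻¹)`
  have hg₁inv : ((g₁⁻¹ : GL (Fin 2) F) : Matrix (Fin 2) (Fin 2) F) = Matrix.diagonal ![1, ϖ⁻¹] := by
    have hprod : (g₁ : Matrix (Fin 2) (Fin 2) F) * Matrix.diagonal ![1, ϖ⁻¹] = 1 := by
      rw [hg₁, diagonal_mul_diagonal, ← diagonal_one]
      congr 1
      funext i
      fin_cases i <;> simp [mul_inv_cancel₀ h0]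
    rw [Matrix.coe_units_inv]
    exact Matrix.inv_eq_right_inv hprod
  have hmap₁ : ((g₁⁻¹ : GL (Fin 2) F) : Matrix (Fin 2) (Fin 2) F).map ι = Matrix.diagonal ![1, (ι ϖ)⁻¹] := by
    rw [hg₁inv]
    ext i j
    fin_cases i <;> fin_cases j <;> simp [Matrix.diagonal]
  have hmap₂ : (g₁ : Matrix (Fin 2) (Fin 2) F).map ι = Matrix.diagonal ![1, ι ϖ] := by
    rw [hg₁]
    ext i j
    fin_cases i <;> fin_cases j <;> simp [Matrix.diagonal]
  have hL : Matrix.diagonal ![(1 : E), (ι ϖ)⁻¹] * Matrix.diagonal ![1, α] = Matrix.diagonal ![1, α * (ι ϖ)⁻¹] := by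
    rw [diagonal_mul_diagonal]; congr 1; funext i; fin_cases i <;> simp [mul_comm]
  have hR : Matrix.diagonal ![(1 : E), α⁻¹] * Matrix.diagonal ![1, ι ϖ] = Matrix.diagonal ![1, (α * (ι ϖ)⁻¹)⁻¹] := by
    rw [diagonal_mul_diagonal]; congr 1; funext i; fin_cases i <;> simp [mul_comm]
  rw [hmap₁, hmap₂, show Matrix.diagonal ![(1 : E), (ι ϖ)⁻¹] * (Matrix.diagonal ![1, α] * ((u : GL (Fin 2) E) : Matrix (Fin 2) (Fin 2) E) *
      Matrix.diagonal ![1, α⁻¹]) * Matrix.diagonal ![1, ι ϖ] = (Matrix.diagonal ![(1 : E), (ι ϖ)⁻¹] * Matrix.diagonal ![1, α]) *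
      ((u : GL (Fin 2) E) : Matrix (Fin 2) (Fin 2) E) * (Matrix.diagonal ![1, α⁻¹] * Matrix.diagonal ![1, ι ϖ]) by simp only [Matrix.mul_assoc], hL, hR]

end Stabilisers

/-! ## §4 Dictionary with the level notation `U ∩ D·GL₂(𝒪_E)·D⁻¹` -/

omit [ValuativeRel F] in
/-- `D⁻¹ u D` is unimodular iff `u ∈ D · GL₂(𝒪_E) · D⁻¹ = (glInt 2 E).map (MulAut.conj D)` (B-p14's `K♯_D` before intersecting with `U`). [cite: Tits1979, §3.9] -/
theorem isUnimodular₂_conj_iff_mem_map_conj_glInt (D u : GL (Fin 2) E) :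
    IsUnimodular₂ (((D⁻¹ : GL (Fin 2) E) : Matrix (Fin 2) (Fin 2) E) * (u : Matrix (Fin 2) (Fin 2) E) * (D : Matrix (Fin 2) (Fin 2) E)) ↔
      u ∈ (glInt 2 E).map (MulAut.conj D).toMonoidHom := by
  rw [isUnimodular₂_iff_exists_mem_glInt]
  constructor
  · rintro ⟨k, hk, hkval⟩
    refine ⟨k, hk, ?_⟩
    rw [MulEquiv.coe_toMonoidHom, MulAut.conj_apply]
    have hk' : k = D⁻¹ * u * D := Units.ext (by rw [hkval, Units.val_mul, Units.val_mul])
    rw [hk']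
    group
  · rintro ⟨k, hk, hku⟩
    rw [MulEquiv.coe_toMonoidHom, MulAut.conj_apply] at hku
    refine ⟨k, hk, ?_⟩
    rw [← hku, ← Units.val_mul, ← Units.val_mul]
    congr 1
    group

end Literature.NumberTheory.Automorphic.UnitaryGroup

end
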